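import Mathlib
import Summits.ResolutionOfSingularities.ResolutionOfSingularities.Theorems.WildQuotientsKiralyLutkebohmert
import Literature.RingTheory.GaloisAlgebras.ChaseHarrisonRosenberg
import Literature.AlgebraicGeometry.Resolution.RegularLocalRingsFlatDescent

/-!
# Cyclic divisorial transfer — the local algebra (crux stmt-ResolutionOfSingularities-15640, line `Sketch`, lead c8)

Pure commutative algebra behind "Király–Lütkebohmert terminal state ⟹ regular quotient": `B` a domain,
`σ` a ring automorphism of prime order `p`, `A = B^σ = eqLocus σ id`, `𝔮 ⊂ B` prime, `𝔭 = 𝔮 ∩ A`.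
* fixed prime (`σ𝔮 = 𝔮`): `A_𝔭 ≅ (B_𝔮)^σ` (`stub_locFixed`), hence `A_𝔭` regular when `B_𝔮` is regular and
  the augmentation ideal is principal at `𝔮` (Király–Lütkebohmert, PROVED in tree) (`stub_locFixedRegular`);
* free prime (`σ𝔮 ≠ 𝔮`): `A_𝔭 → B_𝔮` is flat (Chase–Harrison–Rosenberg on `S⁻¹B`, `S = A ∖ 𝔭`)
  (`stub_locFreeFlat`), hence `A_𝔭` regular when `B_𝔮` is (flat local descent).
-/

set_option linter.dupNamespace false

noncomputable section

open IsLocalRing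

namespace Summit.ResolutionOfSingularities.ResolutionOfSingularities.Theorems.WildQuotientResolution.CyclicTransfer

/-- STUB `stub_locFixed` (M, classical): invariants commute with localisation at a TOTALLY RAMIFIED prime.
`B` a domain, `σ` an automorphism with `σ ^ p = 1` (`p` prime), `A = B^σ`, `𝔮` a prime of `B` with `σ⁻¹𝔮 = 𝔮`,
`𝔭 = 𝔮 ∩ A`, and `σ'` ANY automorphism of `B_𝔮` compatible with `σ`. Then the canonical local map
`A_𝔭 → B_𝔮` is injective with image the fixed ring of `σ'`. (Every `t ∈ B ∖ 𝔮` divides its norm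
`N t = ∏_{i<p} σⁱ t ∈ A ∖ 𝔭`, so `B_𝔮 = S⁻¹B` with `S = A ∖ 𝔭`, and `(S⁻¹B)^σ = S⁻¹A` in a domain.)
[folklore; Bourbaki AC V §1 no. 9 Prop. 23] -/
theorem stub_locFixed {B : Type} [CommRing B] [IsDomain B] {p : ℕ}
    (σ : B ≃+* B) (hσp : σ ^ p = RingEquiv.refl B)
    (𝔮 : Ideal B) [𝔮.IsPrime] (h𝔮 : 𝔮.comap σ = 𝔮)
    (σ' : Localization.AtPrime 𝔮 ≃+* Localization.AtPrime 𝔮)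
    (hσ' : ∀ b : B, σ' (algebraMap B (Localization.AtPrime 𝔮) b) =
      algebraMap B (Localization.AtPrime 𝔮) (σ b)) :
    Function.Injective (Localization.localRingHom (𝔮.comap ((σ : B →+* B).eqLocus (RingHom.id B)).subtype) 𝔮
        ((σ : B →+* B).eqLocus (RingHom.id B)).subtype rfl) ∧
      (Localization.localRingHom (𝔮.comap ((σ : B →+* B).eqLocus (RingHom.id B)).subtype) 𝔮
        ((σ : B →+* B).eqLocus (RingHom.id B)).subtype rfl).range =
        (σ' : Localization.AtPrime 𝔮 →+* Localization.AtPrime 𝔮).eqLocus (RingHom.id _) := by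
  sorry

/-- STUB `stub_locFixedRegular` (M, classical + Király–Lütkebohmert): at a totally ramified prime the local ring
of the fixed ring is regular. `B` a domain, `σ ≠ 1` of prime order `p`, `A = B^σ`, `𝔮` a `σ`-fixed prime with
`B_𝔮` regular local and the augmentation ideal `(σ b - b : b ∈ B)` principal after localisation at `𝔮`; GIVEN
that `A_𝔭 → B_𝔮` is injective with image the fixed ring of an automorphism `σ'` of `B_𝔮` compatible with `σ`
(the output of `stub_locFixed`, wired by the lead), `A_𝔭` is a regular local ring: `σ'` has order `p`, is
`≠ 1` (`B ↪ B_𝔮`), its augmentation ideal is the extension of that of `σ`, hence principal, so `(B_𝔮)^{σ'}`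
is regular by Király–Lütkebohmert Thm 2 (`Theorems.kl_isRegularLocalRing_eqLocus`, proved), and
`A_𝔭 ≅ (B_𝔮)^{σ'}`. [cite: KiralyLutkebohmert2013, Thm 2] -/
theorem stub_locFixedRegular {B : Type} [CommRing B] [IsDomain B] {p : ℕ} (hp : p.Prime)
    (σ : B ≃+* B) (hσ1 : σ ≠ RingEquiv.refl B) (hσp : σ ^ p = RingEquiv.refl B)
    (𝔮 : Ideal B) [𝔮.IsPrime] [IsRegularLocalRing (Localization.AtPrime 𝔮)]
    (hdiv : ((Ideal.span (Set.range fun b : B => σ b - b)).map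
      (algebraMap B (Localization.AtPrime 𝔮))).IsPrincipal)
    (σ' : Localization.AtPrime 𝔮 ≃+* Localization.AtPrime 𝔮)
    (hσ' : ∀ b : B, σ' (algebraMap B (Localization.AtPrime 𝔮) b) =
      algebraMap B (Localization.AtPrime 𝔮) (σ b))
    (hinj : Function.Injective (Localization.localRingHom
        (𝔮.comap ((σ : B →+* B).eqLocus (RingHom.id B)).subtype) 𝔮
        ((σ : B →+* B).eqLocus (RingHom.id B)).subtype rfl))
    (hrange : (Localization.localRingHom (𝔮.comap ((σ : B →+* B).eqLocus (RingHom.id B)).subtype) 𝔮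
        ((σ : B →+* B).eqLocus (RingHom.id B)).subtype rfl).range =
        (σ' : Localization.AtPrime 𝔮 →+* Localization.AtPrime 𝔮).eqLocus (RingHom.id _)) :
    IsRegularLocalRing
      (Localization.AtPrime (𝔮.comap ((σ : B →+* B).eqLocus (RingHom.id B)).subtype)) := by
  sorry

/-- STUB `stub_locFreeFlat` (M–L, classical — Chase–Harrison–Rosenberg): at a prime MOVED by `σ` the fixed
ring is flat below. `B` a domain, `σ` of prime order `p` (`σ ^ p = 1`), `A = B^σ`, `𝔮` a prime with
`σ⁻¹𝔮 ≠ 𝔮`, `𝔭 = 𝔮 ∩ A`. Then the canonical local map `A_𝔭 → B_𝔮` is flat. (The `σ`-orbit of `𝔮` consists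
of `p` pairwise distinct primes over `𝔭`, pairwise incomparable, and the augmentation ideal `I = (σ b - b)` lies
in none of them, so prime avoidance gives `c ∈ I` outside all `σʲ𝔮`; its norm `f = ∏_{j<p} σʲ c ∈ A ∖ 𝔭` lies
in `I`, so on `S⁻¹B` (`S = A ∖ 𝔭`) every power `σⁱ ≠ 1` has unit augmentation ideal — a FREE action of
`ℤ/p` with ring of invariants `S⁻¹A = A_𝔭` — and `S⁻¹B` is flat (indeed projective) over `A_𝔭` by
Chase–Harrison–Rosenberg (`Literature.RingTheory.GaloisAlgebras.flat_of_free`); `B_𝔮` is a localisation of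
`S⁻¹B`.) [cite: Greither1992CyclicGalois, Ch. 0 Thm. 1.6; SGA1 Exp. V Prop. 2.2] -/
theorem stub_locFreeFlat {B : Type} [CommRing B] [IsDomain B] {p : ℕ} (hp : p.Prime)
    (σ : B ≃+* B) (hσp : σ ^ p = RingEquiv.refl B)
    (𝔮 : Ideal B) [𝔮.IsPrime] (h𝔮 : 𝔮.comap σ ≠ 𝔮) :
    (Localization.localRingHom (𝔮.comap ((σ : B →+* B).eqLocus (RingHom.id B)).subtype) 𝔮
        ((σ : B →+* B).eqLocus (RingHom.id B)).subtype rfl).Flat := by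
  sorry

/-! ## Assembly of the local algebra (lead) -/

/-- The automorphism of `B_𝔮` induced by `σ` at a `σ`-fixed prime `𝔮`. -/
def locAut {B : Type} [CommRing B] (σ : B ≃+* B) (𝔮 : Ideal B) [𝔮.IsPrime]
    (h𝔮 : 𝔮.comap σ = 𝔮) :
    Localization.AtPrime 𝔮 ≃+* Localization.AtPrime 𝔮 :=
  IsLocalization.ringEquivOfRingEquiv (Localization.AtPrime 𝔮) (Localization.AtPrime 𝔮) σ
    (by
      have key : ∀ y : B, y ∈ 𝔮 ↔ σ y ∈ 𝔮 := fun y => by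
        conv_lhs => rw [← h𝔮]
        exact Ideal.mem_comap
      apply le_antisymm
      · rintro _ ⟨y, hy, rfl⟩
        exact Ideal.mem_primeCompl_iff.mpr fun hx => Ideal.mem_primeCompl_iff.mp hy ((key y).mpr hx)
      · intro x hx
        refine ⟨σ.symm x, Ideal.mem_primeCompl_iff.mpr fun h => Ideal.mem_primeCompl_iff.mp hx ?_,
          σ.apply_symm_apply x⟩
        simpa only [σ.apply_symm_apply] using (key (σ.symm x)).mp h)

/-- `locAut` extends `σ`. -/
theorem locAut_algebraMap {B : Type} [CommRing B] (σ : B ≃+* B) (𝔮 : Ideal B) [𝔮.IsPrime]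
    (h𝔮 : 𝔮.comap σ = 𝔮) (b : B) :
    locAut σ 𝔮 h𝔮 (algebraMap B _ b) = algebraMap B _ (σ b) := by
  unfold locAut
  exact IsLocalization.ringEquivOfRingEquiv_eq _ b

/-- **The local algebra of the cyclic divisorial transfer.** `B` a regular domain, `σ ≠ 1` an automorphism of
prime order `p` with Noetherian fixed ring `A = B^σ`, such that at every `σ`-FIXED prime `𝔮` the augmentation
ideal `(σ b - b)` becomes principal in `B_𝔮` (the Király–Lütkebohmert terminal state). Then `A` is a regular
ring: at a fixed prime by `stub_locFixed` + Király–Lütkebohmert (`stub_locFixedRegular`), at a moved prime by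
flatness (`stub_locFreeFlat`) and flat local descent of regularity (Matsumura 23.7 (i)).
[cite: KiralyLutkebohmert2013, Thm 2] -/
theorem isRegularRing_eqLocus {B : Type} [CommRing B] [IsDomain B] [IsRegularRing B] {p : ℕ}
    (hp : p.Prime) (σ : B ≃+* B) (hσ1 : σ ≠ RingEquiv.refl B) (hσp : σ ^ p = RingEquiv.refl B)
    [IsNoetherianRing ((σ : B →+* B).eqLocus (RingHom.id B))]
    (hdiv : ∀ (𝔮 : Ideal B) [𝔮.IsPrime], 𝔮.comap σ = 𝔮 →
      ((Ideal.span (Set.range fun b : B => σ b - b)).map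
        (algebraMap B (Localization.AtPrime 𝔮))).IsPrincipal) :
    IsRegularRing ((σ : B →+* B).eqLocus (RingHom.id B)) := by
  sorry

end Summit.ResolutionOfSingularities.ResolutionOfSingularities.Theorems.WildQuotientResolution.CyclicTransfer

end
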